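import Literature.NumberTheory.Sieve.BombieriFriedlanderIwaniecBoxes
import HarnessLib

/-!
# Polymath 8a, §3: multilinear expansion of the Heath-Brown terms along the finer-than-dyadic partition of unity

Support file for the named fact `Literature.NumberTheory.Sieve.mpz_of_lt` (**parity.S29**,
`ParityWave0.lean`): D. H. J. Polymath, *New equidistribution estimates of Zhang type*, Algebra &
Number Theory 8:9 (2014) 2067–2199 = arXiv:1402.0811.  In the proof of Lemma 2.7 (§3), after the
Heath-Brown identity (tree: `heathBrown_identity`) each term `μ_≤^{⋆j} ⋆ 1^{⋆(j−1)} ⋆ L` is expanded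
along the smooth partition of unity `1 = ∑_{N ∈ D} ψ_N` (tree: `Polymath8aPartitionOfUnity.lean`):
"`(μ_≤^{⋆j} ⋆ 1^{⋆(j−1)} ⋆ L) 1_{[x,2x]} = ∑_{N_1,…,N_{2j} ∈ D} {(ψ_{N_1} μ_≤) ⋆ ⋯ ⋆ (ψ_{N_j} μ_≤) ⋆
ψ_{N_{j+1}} ⋆ ⋯ ⋆ ψ_{N_{2j}} L} 1_{[x,2x]}`".  This file PROVES that expansion for an arbitrary finite
Dirichlet product and an arbitrary finite partition of unity on an initial segment (cf. the sharp-box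
analogue `BFI.prod_apply_eq_sum_prod_boxRestrict_apply` of the tree's BFI formalisation, whose
`BFI.prod_apply_eq_of_eqOn` and `HeathBrown.finset_sum_apply` are reused):

* `prod_apply_eq_sum_prod_pmul_apply` — if `∑_{m ≤ M} W_m(n) = 1` for `1 ≤ n ≤ T` then
  `(∏_i f_i)(n) = ∑_{κ : [k] → [M+1]} (∏_i W_{κ(i)} · f_i)(n)` for `n ≤ T` (`Finset.prod_univ_sum`);
* `card_tuples` — there are `(M+1)^k` tuples; `exists_arithmeticFunction_eq` — a weight sequence
  as an arithmetic function.

Nothing here discharges `mpz_of_lt`.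

## References

* D. H. J. Polymath, *New equidistribution estimates of Zhang type*, Algebra & Number Theory 8:9
  (2014), 2067–2199, arXiv:1402.0811: §3, proof of Lemma 2.7 (the decompositions along `D`).
  [cite: Polymath8a2014]
-/

open Finset

namespace Literature.NumberTheory.Sieve

namespace Polymath8a

/-- **Multilinear expansion of a Dirichlet product along a partition of unity** (the step "We thus
have decompositions `1 = ∑_{N ∈ D} ψ_N`, `μ_≤ = ∑_{N ∈ D} ψ_N μ_≤`, `L = ∑_{N ∈ D} ψ_N L` …
`(μ_≤^{⋆j} ⋆ 1^{⋆(j−1)} ⋆ L) 1_{[x,2x]} = ∑_{N_1,…,N_{2j} ∈ D} {(ψ_{N_1} μ_≤) ⋆ ⋯ ⋆ ψ_{N_{2j}} L} 1_{[x,2x]}`"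
of the proof of Polymath 8a Lemma 2.7, §3): if the weights `W_0, …, W_M` satisfy
`∑_m W_m(n) = 1` for `1 ≤ n ≤ T`, then for every `n ≤ T`,
`(∏_i f_i)(n) = ∑_{κ : [k] → [M+1]} (∏_i W_{κ(i)} · f_i)(n)` (pointwise products `W · f` as
Mathlib's `ArithmeticFunction.pmul`, Dirichlet products as Mathlib's product).  With the smooth
cutoffs of `Polymath8aPartitionOfUnity.lean` (`sum_range_cutoff_eq_one`) this is the finer-than-dyadic
decomposition; the number of tuples is `(M+1)^k` (`card_tuples`).
[cite: Polymath8a2014, §3, proof of Lemma 2.7 (the decomposition into the pieces ψ_N)] -/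
theorem prod_apply_eq_sum_prod_pmul_apply {k M T : ℕ} (f : Fin k → ArithmeticFunction ℝ)
    (W : Fin (M + 1) → ArithmeticFunction ℝ) (hW : ∀ n : ℕ, 1 ≤ n → n ≤ T → ∑ m, W m n = 1)
    {n : ℕ} (hn : n ≤ T) :
    (∏ i, f i) n = ∑ κ : Fin k → Fin (M + 1), (∏ i, (W (κ i)).pmul (f i)) n := by
  classical
  -- replace each factor by its decomposition, which agrees with it on `[1, T]`
  have h1 : (∏ i, f i) n = (∏ i, ∑ m, (W m).pmul (f i)) n := by
    refine BFI.prod_apply_eq_of_eqOn Finset.univ (fun i _ d hd => ?_) n hn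
    rw [HeathBrown.finset_sum_apply]
    simp only [ArithmeticFunction.pmul_apply]
    rcases Nat.eq_zero_or_pos d with rfl | hd0
    · simp
    · rw [← Finset.sum_mul, hW d hd0 hd, one_mul]
  rw [h1, Finset.prod_univ_sum, HeathBrown.finset_sum_apply]
  simp only [Fintype.piFinset_univ]

/-- The number of tuples in the expansion: `#([k] → [M+1]) = (M+1)^k` (so `≪ log^{O(1)} x` tuples
for `M ≍ log x · log^{A₀} x`, as "there are at most `≪ log^{2j(A₀+1)} x` tuples" in the paper).
[cite: Polymath8a2014, §3, proof of Lemma 2.7] -/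
theorem card_tuples (k M : ℕ) : Fintype.card (Fin k → Fin (M + 1)) = (M + 1) ^ k := by
  simp

/-- The weights of the finer-than-dyadic decomposition as arithmetic functions: for a real sequence
`w` the arithmetic function `n ↦ w n` (`n ≥ 1`), `0 ↦ 0`. [folklore] -/
theorem exists_arithmeticFunction_eq (w : ℕ → ℝ) :
    ∃ W : ArithmeticFunction ℝ, ∀ n : ℕ, 1 ≤ n → W n = w n :=
  ⟨⟨fun n => if n = 0 then 0 else w n, if_pos rfl⟩, fun n hn => if_neg (by omega)⟩

end Polymath8a

end Literature.NumberTheory.Sieve
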